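import Mathlib
import Literature.NumberTheory.LFunctions.Zhang2022.Section10cLamAvgRule
import Literature.NumberTheory.LFunctions.Zhang2022.Section10cLow1214Int
import Literature.NumberTheory.LFunctions.Zhang2022.Section8AbelProfiles
import Literature.NumberTheory.LFunctions.Zhang2022.Section8ProfilesAtPz
import Literature.NumberTheory.LFunctions.Zhang2022.Section8SubstitutionEngine
import Literature.NumberTheory.LFunctions.Zhang2022.Section10RangeAverage
import HarnessLib

/-!
# Zhang (2022) §10c: profile calculus for the "n-sum → z-integral" nodes — selectors, `β_j log P`,
# `𝔞 = c_D L′(1,χ)²`, the logarithmic prefactors, and the top-range profile of `S_j(𝐚₁₄,𝐚₂₂)`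

Topic `Literature/NumberTheory/LFunctions/Zhang2022` (Landau–Siegel audit tree; verdict-neutral).
Y. Zhang, *Discrete mean estimates and the Landau–Siegel zero*, arXiv:2211.02515v1 (2022)
[Zhang2022LandauSiegel], §10 pp. 59–61 and §8 pp. 47–49 — **an unrefereed manuscript under adjudication; this
file asserts nothing about its Theorems 1–2.** D-0069 campaign, discharge layer L3 (seat sz-d34;
staged 2026-08-26T02:11Z as `HOME/staging/L3/sz-d34/Section10cProfiles.lean`, sha16 `7f4c043f9c93f793`,
filed unchanged in content by the ZHANG-L discharge lane, seat zl-w10-p5, WP10).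
Theorem-only infrastructure for the §10c nodes `Mid1422Int`, `Top1422Int`, `Low1214X`, `Mid1214Int`,
`Top1214Int` (the displays "`= (…𝔞/log P)∫…dz + o(α)`"):

* `sel_eq` — the `j`-dispatchers of §8d (`ffP/ghP`, sz-L2-t9) and of §10c (`ffJ6/…`, L3-t8) agree;
* `norm_betaJ_mul_log_sub_le` — `‖β_j log P − jπi‖ ≤ 15π|c′α𝓛|` ((2.13), `α log P = π`);
* `frakA_eq_cD_mul` — `𝔞 = c_D·L′(1,χ)²`, `c_D = (6/π²)∏_{q∣D}q/(q+1)` (`Lemma171.frakAC_eq`; the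
  bounds `0 ≤ c_D ≤ 1` and `|L′(1,χ)| ≤ 4e^{9/2}𝓛²` are the tree's `RangeAverage.frakcD_bounds` and
  `Lemma31.norm_deriv_LFunction_le_near_one`); `forAllLarge_five_c` — eventually `D ≥ 3`,
  `𝓛 ≥ 6`, `5|c′|α𝓛 ≤ 1`;
* `logFactor_bounds` — `t ↦ a + sβ_j log(Q/t)` on `[1, P]`: differentiable, `≤ 1 + 4π`, derivative
  `≤ 4α/t` (sz-d29's `Section8AbelProfiles.hasDerivAt_ofReal_log_div`, `norm_betaJ_le`);
* `topG1422_bounds` — the top-range profile `G(t) = (1 − β_j log(P^{0.5}/t))𝔤_{j7}(P^{0.5}/t)` of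
  `S_j(𝐚₁₄,𝐚₂₂)` (p. 60): differentiable, `‖G‖ ≤ 146(1+4π)`, `‖G′(t)‖ ≤ (584 + 449(1+4π))α/t`
  (with `Section8AbelProfiles.frakgW_div_bounds`, `mul_bounds`).

## References

* Y. Zhang, arXiv:2211.02515v1 (2022), §10 pp. 59–61; §8 (8.13)–(8.18); §2 (2.13), (2.31).
  [cite: Zhang2022LandauSiegel, §10 pp. 59–61]
-/

noncomputable section

open Complex Real ComplexConjugate
open Literature.NumberTheory.LFunctions.Zhang2022.Skeleton

namespace Literature.NumberTheory.LFunctions.Zhang2022.Typed.Sec10C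

section Profiles

open Literature.NumberTheory.LFunctions.Zhang2022.Section8dStatements (ffP ghP)

/-! ### Bridges between the `j`-selectors of §8d (`ffP/ghP`, `j % 3`) and of §10c (`ffJ6, …`) -/

/-- `ghP j 7 = 𝔤𝔥_{j7}` and `ghP j 6 = 𝔤𝔥_{j6}` for `j = 1, 2, 3`; same for `ffP`.
[cite: Zhang2022LandauSiegel, §8 (8.13)–(8.18)] -/
theorem sel_eq {j : ℕ} (hj : j ∈ ({1, 2, 3} : Finset ℕ)) :
    ghP j 7 = ghJ7 j ∧ ghP j 6 = ghJ6 j ∧ ffP j 7 = ffJ7 j ∧ ffP j 6 = ffJ6 j := by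
  simp only [Finset.mem_insert, Finset.mem_singleton] at hj
  rcases hj with rfl | rfl | rfl <;>
    simp [ghP, ffP, ghJ7, ghJ6, ffJ7, ffJ6, byJ]

/-! ### The shifts against `log P`, and the size of `L′(1,χ)` -/

/-- `‖β_j log P − jπi‖ ≤ 15π|c′α𝓛|` for `j = 1, 2, 3` ((2.13) with `α log P = π`).
[cite: Zhang2022LandauSiegel, §2 (2.13)] -/
theorem norm_betaJ_mul_log_sub_le (c' : ℝ) {D : ℕ} (hΛ : 0 < Real.log (bigP D)) {j : ℕ}
    (hj : j ∈ ({1, 2, 3} : Finset ℕ)) :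
    ‖betaJ c' D j * (Real.log (bigP D) : ℂ) - (j : ℂ) * π * I‖ ≤ 15 * π * |c' * alpha D * ell D| := by
  have hΛ0 : (Real.log (bigP D) : ℂ) ≠ 0 := by exact_mod_cast hΛ.ne'
  have hα : (alpha D : ℂ) = π / (Real.log (bigP D) : ℂ) := by rw [alpha, Complex.ofReal_div]
  have hπ : 0 ≤ π := Real.pi_pos.le
  have hu := abs_nonneg (c' * alpha D * ell D)
  have key : ∀ (n : ℕ) (s : ℝ), (n : ℝ) * |s| ≤ 15 → ∀ β : ℂ,
      β * (Real.log (bigP D) : ℂ) - (n : ℂ) * π * I = ((n * s * π * (c' * alpha D * ell D) : ℝ) : ℂ) * I →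
      ‖β * (Real.log (bigP D) : ℂ) - (n : ℂ) * π * I‖ ≤ 15 * π * |c' * alpha D * ell D| := by
    intro n s hs β h
    rw [h, norm_mul, Complex.norm_I, mul_one, Complex.norm_real, Real.norm_eq_abs, abs_mul, abs_mul,
      abs_mul, abs_of_nonneg hπ, Nat.abs_cast]
    calc (n : ℝ) * |s| * π * |c' * alpha D * ell D| = ((n : ℝ) * |s|) * (π * |c' * alpha D * ell D|) := by
          ring
      _ ≤ 15 * (π * |c' * alpha D * ell D|) := mul_le_mul_of_nonneg_right hs (by positivity)
      _ = 15 * π * |c' * alpha D * ell D| := by ring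
  simp only [Finset.mem_insert, Finset.mem_singleton] at hj
  rcases hj with rfl | rfl | rfl
  · refine key 1 (-5) (by norm_num) _ ?_
    simp only [betaJ, beta1]; norm_num; rw [hα]; field_simp; ring
  · refine key 2 1 (by norm_num) _ ?_
    simp only [betaJ, beta2]; norm_num; rw [hα]; field_simp; ring
  · refine key 3 (-1) (by norm_num) _ ?_
    simp only [betaJ, beta3]; norm_num; rw [hα]; field_simp; ring

/-- A real primitive character to a modulus `D ≥ 2` is `≠ 1` and has `χ² = 1`. [folklore] -/
private theorem chi_ne_one_sq {D : ℕ} [NeZero D] (χ : DirichletCharacter ℂ D) (hD : 2 ≤ D)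
    (hq : χ.IsQuadratic) (hp : χ.IsPrimitive) : χ ≠ 1 ∧ χ ^ 2 = 1 := by
  refine ⟨?_, hq.sq_eq_one⟩
  rintro rfl
  rw [DirichletCharacter.isPrimitive_def, DirichletCharacter.conductor_one] at hp
  omega

/-- `𝔞 = c_D·L′(1,χ)²` as complex numbers, `c_D = (6/π²)∏_{q∣D}q/(q+1)` (the tree's
`Lemma171.frakAC_eq`: `L′(1,χ)` is real for real `χ`). [cite: Zhang2022LandauSiegel, §2 (2.31)] -/
theorem frakA_eq_cD_mul {D : ℕ} [NeZero D] (χ : DirichletCharacter ℂ D) (hD : 2 ≤ D)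
    (hq : χ.IsQuadratic) (hp : χ.IsPrimitive) :
    (frakA χ : ℂ) =
      (((6 / π ^ 2 * ∏ q ∈ D.primeFactors, ((q : ℝ) / (q + 1)) : ℝ)) : ℂ) * deriv χ.LFunction 1 ^ 2 := by
  obtain ⟨h1, h2⟩ := chi_ne_one_sq χ hD hq hp
  rw [frakA, ← Lemma171.frakAC_eq χ h1 h2, Lemma171.frakAC]
  push_cast
  ring

/-- Eventually `D ≥ 3`, `𝓛 ≥ 6` and `5|c′|α𝓛 ≤ 1` (the largeness used by the §8 profile bounds).
[cite: Zhang2022LandauSiegel, §2 (2.1), (2.10)] -/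
theorem forAllLarge_five_c (c' : ℝ) :
    ForAllLarge fun D _ _ => 3 ≤ D ∧ 6 ≤ ell D ∧ 5 * |c'| * alpha D * ell D ≤ 1 := by
  refine ⟨⌈Real.exp (max 6 (5 * |c'| * π + 1))⌉₊, fun D _ χ hD _ _ => ?_⟩
  have hexp : Real.exp (max 6 (5 * |c'| * π + 1)) ≤ D := le_trans (Nat.le_ceil _) (by exact_mod_cast hD)
  have hD0 : (0 : ℝ) < D := lt_of_lt_of_le (Real.exp_pos _) hexp
  have hℓ : max 6 (5 * |c'| * π + 1) ≤ ell D := by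
    rw [ell]; exact (Real.le_log_iff_exp_le hD0).mpr hexp
  have h6 : 6 ≤ ell D := le_trans (le_max_left _ _) hℓ
  have hc : 5 * |c'| * π + 1 ≤ ell D := le_trans (le_max_right _ _) hℓ
  have hℓ0 : 0 < ell D := by linarith
  have hD3 : 3 ≤ D := by
    rcases Nat.lt_or_ge D 3 with h | h
    · have h2 : (D : ℝ) ≤ 2 := by exact_mod_cast (by omega : D ≤ 2)
      have : ell D ≤ Real.log 2 := by rw [ell]; exact Real.log_le_log hD0 h2
      have := Real.log_two_lt_d9
      linarith
    · exact h
  refine ⟨hD3, h6, ?_⟩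
  rw [show 5 * |c'| * alpha D * ell D = 5 * |c'| * (alpha D * ell D) by ring, alpha_mul_ell hℓ0,
    ← mul_div_assoc, div_le_one (by positivity)]
  calc 5 * |c'| * π ≤ ell D := by linarith
    _ = ell D ^ 1 := (pow_one _).symm
    _ ≤ ell D ^ 8 := pow_le_pow_right₀ (by linarith) (by norm_num)

/-! ### The logarithmic prefactors `a ± β_j log(Q/t)` as profiles -/

/-- For `‖a‖ ≤ 1`, `‖s‖ ≤ 1`, `1 ≤ Q, t ≤ P`: `t ↦ a + s·β_j·log(Q/t)` is differentiable with
`‖·‖ ≤ 1 + 4π` and `‖d/dt‖ ≤ 4α/t` (uses `‖β_j‖ ≤ 4α`, `α log P = π`).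
[cite: Zhang2022LandauSiegel, §10 p. 59] -/
theorem logFactor_bounds (c' : ℝ) {D : ℕ} (j : ℕ) {a s : ℂ} (ha : ‖a‖ ≤ 1) (hs : ‖s‖ ≤ 1)
    (hα : 0 < alpha D) (hℓ : 0 ≤ ell D) (hc : 5 * |c'| * alpha D * ell D ≤ 1) {Q t : ℝ}
    (hQ1 : 1 ≤ Q) (hQP : Q ≤ bigP D) (ht1 : 1 ≤ t) (htP : t ≤ bigP D) :
    DifferentiableAt ℝ (fun u : ℝ => a + s * (betaJ c' D j * (Real.log (Q / u) : ℂ))) t ∧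
      ‖a + s * (betaJ c' D j * (Real.log (Q / t) : ℂ))‖ ≤ 1 + 4 * π ∧
      ‖deriv (fun u : ℝ => a + s * (betaJ c' D j * (Real.log (Q / u) : ℂ))) t‖ ≤
        4 * alpha D / t := by
  have ht0 : 0 < t := by linarith
  have hQ0 : 0 < Q := by linarith
  have hβ := Section8AbelProfiles.norm_betaJ_le c' hα.le hℓ hc j
  have hd : HasDerivAt (fun u : ℝ => a + s * (betaJ c' D j * (Real.log (Q / u) : ℂ)))
      (s * (betaJ c' D j * (-((t : ℂ)⁻¹)))) t :=
    (((Section8AbelProfiles.hasDerivAt_ofReal_log_div hQ0 ht0).const_mul _).const_mul _).const_add _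
  refine ⟨hd.differentiableAt, ?_, ?_⟩
  · have hlog : |Real.log (Q / t)| ≤ Real.log (bigP D) :=
      Section8AbelProfiles.abs_log_div_le hQ1 hQP ht1 htP
    have hΛ0 : Real.log (bigP D) ≠ 0 := by
      intro h; rw [alpha, h, div_zero] at hα; exact lt_irrefl _ hα
    have hαΛ : alpha D * Real.log (bigP D) = π := by
      rw [alpha, div_mul_cancel₀ _ hΛ0]
    calc ‖a + s * (betaJ c' D j * (Real.log (Q / t) : ℂ))‖
        ≤ ‖a‖ + ‖s‖ * (‖betaJ c' D j‖ * ‖(Real.log (Q / t) : ℂ)‖) := by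
          refine (norm_add_le _ _).trans ?_
          rw [norm_mul, norm_mul]
      _ ≤ 1 + 1 * (4 * alpha D * Real.log (bigP D)) := by
          gcongr
          rw [Complex.norm_real, Real.norm_eq_abs]; exact hlog
      _ = 1 + 4 * π := by rw [← hαΛ]; ring
  · rw [hd.deriv, norm_mul, norm_mul, norm_neg, norm_inv, Complex.norm_real,
      Real.norm_of_nonneg ht0.le]
    calc ‖s‖ * (‖betaJ c' D j‖ * t⁻¹) ≤ 1 * (4 * alpha D * t⁻¹) := by gcongr
      _ = 4 * alpha D / t := by ring

/-- Sums of profiles keep the `(M, M′/t)` shape (companion of `Section8AbelProfiles.mul_bounds`).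
[cite: Zhang2022LandauSiegel, §8 (8.11) p. 48] -/
theorem add_bounds {f g : ℝ → ℂ} {t A B A' B' : ℝ} (hf : DifferentiableAt ℝ f t)
    (hg : DifferentiableAt ℝ g t) (nf : ‖f t‖ ≤ A) (ng : ‖g t‖ ≤ B) (nf' : ‖deriv f t‖ ≤ A' / t)
    (ng' : ‖deriv g t‖ ≤ B' / t) :
    DifferentiableAt ℝ (fun u => f u + g u) t ∧ ‖f t + g t‖ ≤ A + B ∧
      ‖deriv (fun u => f u + g u) t‖ ≤ (A' + B') / t := by
  refine ⟨hf.add hg, (norm_add_le _ _).trans (add_le_add nf ng), ?_⟩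
  change ‖deriv (f + g) t‖ ≤ (A' + B') / t
  rw [deriv_add hf hg, add_div]
  exact (norm_add_le _ _).trans (add_le_add nf' ng')

/-- Scalar multiples of profiles keep the `(M, M′/t)` shape. [cite: Zhang2022LandauSiegel, §8 (8.11) p. 48] -/
theorem const_mul_bounds {f : ℝ → ℂ} (c : ℂ) {t A A' : ℝ} (hf : DifferentiableAt ℝ f t)
    (nf : ‖f t‖ ≤ A) (nf' : ‖deriv f t‖ ≤ A' / t) :
    DifferentiableAt ℝ (fun u => c * f u) t ∧ ‖c * f t‖ ≤ ‖c‖ * A ∧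
      ‖deriv (fun u => c * f u) t‖ ≤ ‖c‖ * A' / t := by
  refine ⟨hf.const_mul c, ?_, ?_⟩
  · rw [norm_mul]; exact mul_le_mul_of_nonneg_left nf (norm_nonneg _)
  · rw [(hf.hasDerivAt.const_mul c).deriv, norm_mul, mul_div_assoc]
    exact mul_le_mul_of_nonneg_left nf' (norm_nonneg _)

/-! ### `Top1422Int`: the profile, its bounds, its values at `P^z` -/

/-- The profile of the top range of `S_j(𝐚₁₄,𝐚₂₂)` as a function of a real variable:
`G(t) = (1 − β_j log(P^{0.5}/t))𝔤_{j7}(P^{0.5}/t)`, with its bounds on `[1, P]`: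
differentiable, `‖G‖ ≤ 146(1 + 4π)`, `‖G′(t)‖ ≤ (4·146 + (1+4π)·449)α/t`.
[cite: Zhang2022LandauSiegel, §10 p. 60] -/
theorem topG1422_bounds (c' : ℝ) {D : ℕ} (j : ℕ) (hα : 0 < alpha D) (hℓ : 0 ≤ ell D)
    (hc : 5 * |c'| * alpha D * ell D ≤ 1) (hP : bigP D ^ (0.5 : ℝ) ≤ bigP D)
    (hP1 : 1 ≤ bigP D ^ (0.5 : ℝ)) {t : ℝ} (ht1 : 1 ≤ t) (htP : t ≤ bigP D) :
    DifferentiableAt ℝ (fun u : ℝ => (1 - betaJ c' D j * (Real.log (bigP D ^ (0.5 : ℝ) / u) : ℂ)) *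
        frakgW c' D j 7 (bigP D ^ (0.5 : ℝ) / u)) t ∧
      ‖(1 - betaJ c' D j * (Real.log (bigP D ^ (0.5 : ℝ) / t) : ℂ)) *
          frakgW c' D j 7 (bigP D ^ (0.5 : ℝ) / t)‖ ≤ (1 + 4 * π) * 146 ∧
      ‖deriv (fun u : ℝ => (1 - betaJ c' D j * (Real.log (bigP D ^ (0.5 : ℝ) / u) : ℂ)) *
          frakgW c' D j 7 (bigP D ^ (0.5 : ℝ) / u)) t‖ ≤
        (4 * alpha D * 146 + (1 + 4 * π) * (449 * alpha D)) / t := by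
  have hαΛ : alpha D * Real.log (bigP D) ≤ 4 := by
    have : alpha D * Real.log (bigP D) = π := by
      rw [alpha]; field_simp [(show Real.log (bigP D) ≠ 0 from by
        intro h; rw [alpha, h, div_zero] at hα; exact lt_irrefl _ hα)]
    rw [this]; linarith [Real.pi_lt_four]
  obtain ⟨d1, n1, n1'⟩ := logFactor_bounds c' j (a := 1) (s := -1) (by simp) (by simp) hα hℓ hc hP1 hP
    ht1 htP
  obtain ⟨d2, n2, n2'⟩ := Section8AbelProfiles.frakgW_div_bounds c' j 7 hα hℓ hc hP1 hP ht1 htP hαΛ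
  have e : (fun u : ℝ => (1 - betaJ c' D j * (Real.log (bigP D ^ (0.5 : ℝ) / u) : ℂ)) *
      frakgW c' D j 7 (bigP D ^ (0.5 : ℝ) / u)) =
      fun u => (1 + (-1) * (betaJ c' D j * (Real.log (bigP D ^ (0.5 : ℝ) / u) : ℂ))) *
        frakgW c' D j 7 (bigP D ^ (0.5 : ℝ) / u) := by
    funext u; ring
  have e1 : (1 - betaJ c' D j * (Real.log (bigP D ^ (0.5 : ℝ) / t) : ℂ)) =
      1 + (-1) * (betaJ c' D j * (Real.log (bigP D ^ (0.5 : ℝ) / t) : ℂ)) := by ring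
  obtain ⟨d3, n3, n3'⟩ := Section8AbelProfiles.mul_bounds d1 d2 n1 n2 n1' n2' (by positivity)
  rw [e, e1]
  exact ⟨d3, n3, n3'⟩

end Profiles

end Literature.NumberTheory.LFunctions.Zhang2022.Typed.Sec10C
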